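import Mathlib.NumberTheory.ModularForms.CongruenceSubgroups
import Mathlib.Data.ZMod.Basic
import Mathlib.RingTheory.Coprime.Lemmas
import HarnessLib

/-!
# Route `SignedLowerHalves`, crux `KobayashiMainConjectureSmallImage` (item stmt-BirchSwinnertonDyer-19002),
# line `birth_acns` v7, stub `stub_lemmaPrime_three`: **LEMMA′(N,p) ⇐ (★★) «`S_p` generates `Γ′`»** — the factorisation step of
# `EG-REDUCTION-g8` §1 in the kernel (pure group theory of `Γ₀(N)`; cell `bsd-ssimc`, seat `bsd-line-slh-p3` gen 8; THEOREMS ONLY; helper)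

WHAT. `N ≥ 1`, `p` a prime with `p ∤ N`. `S_p := {γ ∈ Γ₀(N) : d(γ) = ±p^k}`, `Γ′ := {γ ∈ Γ₀(N) : d(γ) ≡ ±p^k (mod N)}` (`d(γ)` the lower-right
entry; `γ ↦ d(γ) mod N` is a homomorphism `Γ₀(N) → (ℤ/N)ˣ` because `γ` is upper-triangular mod `N`). **(★★)** (hypothesis `hSS`): `Γ′ ⊆ ⟨S_p⟩`.
**LEMMA′(N,p)** (conclusion, in the exact shape consumed by `SmallImageHeckePrimeMu.exists_norm_ratPlusSymbol_eq_one_of_lemmaPrime`, p639321, and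
registered as `stub_lemmaPrime_three` of line v7 at `p = 3`): every homomorphism `ψ : Γ₀(N) → ℤ/p` killing `S_p` is `χ(d(γ) mod N)` for a homomorphism
`χ : (ℤ/N)ˣ → ℤ/p` with `χ(p̄) = 1`. PROOF: `ψ` kills `⟨S_p⟩ ⊇ Γ′ ⊇ ker(d mod N)`; sections by Bézout matrices `(x, 1; −yN, D)` define `χ(u) := ψ(sect u)`,
a homomorphism because `sect(u)·sect(v)·sect(uv)⁻¹ ∈ ker(d mod N)`. So after this file the registered stub is EXACTLY the generation statement (★★),
which the ideator's EG (Venkataramana 1994 / Vaserstein 1972 + Mennicke 1967 / Serre 1970) and the kernel-checked coset lemma deliver on paper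
(`Cruxes/…/EG-REDUCTION-g8.md` §2–3, `LemmaPrimeTypingPlan.md` §4–5).

HONEST SCOPE: (★★) is a hypothesis; nothing about the crux is asserted; BSD is not proved by any of this. No new named fact, no definition.

References: [Shimura1971] §1.6 (Γ₀(N)); `Cruxes/KobayashiMainConjectureSmallImage/EG-REDUCTION-g8.md` §1–2; [Venkataramana1994] Thm. p. 194; [Serre1970CSP].
-/

-- D-0017: single-problem summit, the namespace repeats the problem name by design.
set_option linter.dupNamespace false
set_option autoImplicit false

open scoped MatrixGroups

open CongruenceSubgroup

namespace Summit.BirchSwinnertonDyer.BirchSwinnertonDyer.Theorems.SmallImageLemmaPrimeReduction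

variable {N : ℕ}

/-! ## §1 `d(γ) mod N` on `Γ₀(N)` (multiplicativity = Mathlib's `Gamma0Map`) -/

/-- `d(γ) mod N` is a unit: `a(γ) d(γ) ≡ 1 (mod N)`. [folklore] -/
theorem abar_mul_dbar (γ : Gamma0 N) :
    ((((γ : SL(2, ℤ)) 0 0 : ℤ) : ZMod N)) * ((((γ : SL(2, ℤ)) 1 1 : ℤ) : ZMod N)) = 1 := by
  have hdet := Matrix.SpecialLinearGroup.det_coe (γ : SL(2, ℤ))
  rw [Matrix.det_fin_two] at hdet
  have hc : ((((γ : SL(2, ℤ)) 1 0 : ℤ)) : ZMod N) = 0 := Gamma0_mem.mp γ.2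
  have h := congr_arg (fun z : ℤ ↦ (z : ZMod N)) hdet
  simp only [Int.cast_sub, Int.cast_mul, Int.cast_one, hc, mul_zero, sub_zero] at h
  exact h

/-- `d(γ⁻¹) ≡ a(γ) (mod N)`, hence `d(γ⁻¹) d(γ) ≡ 1`. [folklore] -/
theorem dbar_inv_mul (γ : Gamma0 N) :
    ((((γ⁻¹ : Gamma0 N) : SL(2, ℤ)) 1 1 : ℤ) : ZMod N) * ((((γ : SL(2, ℤ)) 1 1 : ℤ) : ZMod N)) = 1 := by
  have h : (((γ⁻¹ : Gamma0 N) : SL(2, ℤ)) 1 1 : ℤ) = ((γ : SL(2, ℤ)) 0 0 : ℤ) := by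
    rw [Subgroup.coe_inv, Matrix.SpecialLinearGroup.SL2_inv_expl]
    rfl
  rw [h]
  exact abar_mul_dbar γ

/-! ## §2 Bézout sections of `γ ↦ d(γ) mod N` -/

/-- For `D` prime to `N` there is `γ ∈ Γ₀(N)` with lower-right entry EXACTLY `D` (`(x, 1; −yN, D)`, `xD + yN = 1`). [folklore] -/
theorem exists_gamma0_apply_one_one_eq {D : ℤ} (hD : IsCoprime D (N : ℤ)) :
    ∃ γ : Gamma0 N, ((γ : SL(2, ℤ)) 1 1 : ℤ) = D := by
  obtain ⟨x, y, hxy⟩ := hD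
  let g : SL(2, ℤ) := ⟨!![x, 1; -(y * N), D], by rw [Matrix.det_fin_two_of]; linear_combination hxy⟩
  have hg : g ∈ Gamma0 N := by
    rw [Gamma0_mem]
    show (((-(y * N) : ℤ)) : ZMod N) = 0
    push_cast
    rw [ZMod.natCast_self, mul_zero, neg_zero]
  exact ⟨⟨g, hg⟩, rfl⟩

/-- Every unit of `ℤ/N` is `d(γ) mod N` for some `γ ∈ Γ₀(N)`. [folklore] -/
theorem exists_gamma0_dbar_eq [NeZero N] (u : (ZMod N)ˣ) :
    ∃ γ : Gamma0 N, ((((γ : SL(2, ℤ)) 1 1 : ℤ) : ZMod N)) = (u : ZMod N) := by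
  have hcop : Nat.Coprime (u : ZMod N).val N := ZMod.val_coe_unit_coprime u
  have hD : IsCoprime (((u : ZMod N).val : ℕ) : ℤ) (N : ℤ) := Nat.isCoprime_iff_coprime.mpr hcop
  obtain ⟨γ, hγ⟩ := exists_gamma0_apply_one_one_eq hD
  refine ⟨γ, ?_⟩
  rw [hγ]
  push_cast
  exact ZMod.natCast_zmod_val _

/-! ## §3 LEMMA′(N,p) from (★★) -/

variable {p : ℕ}

/-- **LEMMA′(N,p) ⇐ (★★) «`Γ′ ⊆ ⟨S_p⟩`»** (EG-REDUCTION-g8 §1: «(★★) ⟹ LEMMA′ is immediate»), in the exact shape of `stub_lemmaPrime_three` /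
the hypothesis of `SmallImageHeckePrimeMu.exists_norm_ratPlusSymbol_eq_one_of_lemmaPrime`. Here `Γ′ = {γ : d(γ) ≡ ±p^k (mod N)}`,
`S_p = {γ : d(γ) = ±p^k}`. [cite: Venkataramana1994, Theorem (p. 194) (the input of (★★), not used in this step)] -/
theorem lemmaPrime_of_closure_S [NeZero N]
    (hSS : ∀ γ : Gamma0 N,
      (∃ k : ℕ, ((((γ : SL(2, ℤ)) 1 1 : ℤ) : ZMod N)) = (p : ZMod N) ^ k ∨
        ((((γ : SL(2, ℤ)) 1 1 : ℤ) : ZMod N)) = -((p : ZMod N) ^ k)) →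
      γ ∈ Subgroup.closure {γ : Gamma0 N | ∃ k : ℕ, ((γ : SL(2, ℤ)) 1 1 : ℤ) = (p : ℤ) ^ k ∨
        ((γ : SL(2, ℤ)) 1 1 : ℤ) = -((p : ℤ) ^ k)}) :
    ∀ ψ : Gamma0 N →* Multiplicative (ZMod p),
      (∀ γ : Gamma0 N, (∃ k : ℕ, ((γ : SL(2, ℤ)) 1 1 : ℤ) = (p : ℤ) ^ k ∨ ((γ : SL(2, ℤ)) 1 1 : ℤ) = -((p : ℤ) ^ k)) →
        ψ γ = 1) →
      ∃ χ : (ZMod N)ˣ →* Multiplicative (ZMod p),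
        (∀ u : (ZMod N)ˣ, (u : ZMod N) = (p : ZMod N) → χ u = 1) ∧
        ∀ (γ : Gamma0 N) (u : (ZMod N)ˣ), (u : ZMod N) = (((γ : SL(2, ℤ)) 1 1 : ℤ) : ZMod N) → ψ γ = χ u := by
  intro ψ hkill
  have dbar_mul : ∀ γ δ : Gamma0 N, ((((γ * δ : Gamma0 N) : SL(2, ℤ)) 1 1 : ℤ) : ZMod N) =
      ((((γ : SL(2, ℤ)) 1 1 : ℤ) : ZMod N)) * ((((δ : SL(2, ℤ)) 1 1 : ℤ) : ZMod N)) :=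
    fun γ δ ↦ map_mul (Gamma0Map N) γ δ
  -- `ψ` kills `⟨S_p⟩ ⊇ Γ′`
  have hker : Subgroup.closure {γ : Gamma0 N | ∃ k : ℕ, ((γ : SL(2, ℤ)) 1 1 : ℤ) = (p : ℤ) ^ k ∨
      ((γ : SL(2, ℤ)) 1 1 : ℤ) = -((p : ℤ) ^ k)} ≤ ψ.ker := by
    rw [Subgroup.closure_le]
    intro γ hγ
    exact hkill γ hγ
  have hΓ' : ∀ γ : Gamma0 N, (∃ k : ℕ, ((((γ : SL(2, ℤ)) 1 1 : ℤ) : ZMod N)) = (p : ZMod N) ^ k ∨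
      ((((γ : SL(2, ℤ)) 1 1 : ℤ) : ZMod N)) = -((p : ZMod N) ^ k)) → ψ γ = 1 :=
    fun γ hγ ↦ hker (hSS γ hγ)
  -- in particular `ψ` kills `ker (d mod N)`
  have hker1 : ∀ γ : Gamma0 N, ((((γ : SL(2, ℤ)) 1 1 : ℤ) : ZMod N)) = 1 → ψ γ = 1 :=
    fun γ hγ ↦ hΓ' γ ⟨0, Or.inl (by rw [hγ, pow_zero])⟩
  -- two elements with the same `d mod N` have the same `ψ`
  have hψeq : ∀ γ δ : Gamma0 N, ((((γ : SL(2, ℤ)) 1 1 : ℤ) : ZMod N)) = ((((δ : SL(2, ℤ)) 1 1 : ℤ) : ZMod N)) →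
      ψ γ = ψ δ := by
    intro γ δ hγδ
    have h1 : ((((γ * δ⁻¹ : Gamma0 N) : SL(2, ℤ)) 1 1 : ℤ) : ZMod N) = 1 := by
      rw [dbar_mul, hγδ, mul_comm, dbar_inv_mul]
    have h2 := hker1 (γ * δ⁻¹) h1
    rwa [map_mul, map_inv, mul_inv_eq_one] at h2
  -- Bézout sections
  choose sect hsect using fun u : (ZMod N)ˣ ↦ exists_gamma0_dbar_eq u
  -- `χ u := ψ (sect u)`
  let χ : (ZMod N)ˣ →* Multiplicative (ZMod p) :=
    { toFun := fun u ↦ ψ (sect u)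
      map_one' := hker1 _ (by rw [hsect, Units.val_one])
      map_mul' := fun u v ↦ by
        rw [← map_mul]
        apply hψeq
        rw [dbar_mul, hsect, hsect, hsect, Units.val_mul] }
  have hχ : ∀ u, χ u = ψ (sect u) := fun u ↦ rfl
  refine ⟨χ, ?_, ?_⟩
  · intro u hu
    rw [hχ]
    exact hΓ' _ ⟨1, Or.inl (by rw [hsect, hu, pow_one])⟩
  · intro γ u hu
    rw [hχ]
    exact hψeq γ (sect u) (by rw [hsect, hu])

/-- **LEMMA′(N,p) ⇐ LEMMA′ in homomorphism form** «every homomorphism `Γ₀(N) → (ℤ/p)ˣ` killing `S_p` kills `Γ′`»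
(the form in which bsd-idea-13 g9's kernel file `Cruxes/KobayashiMainConjectureSmallImage/EGLemmaPrime_g9.lean` derives LEMMA′
from the Vaserstein–Liehl relative elementary generation theorem for `SL₂(ℤ[1/p])`; weaker than (★★) «`Γ′ ⊆ ⟨S_p⟩`» of
`lemmaPrime_of_closure_S`, and all that the character factorisation needs). Same conclusion shape as `lemmaPrime_of_closure_S`. -/
theorem lemmaPrime_of_homForm [NeZero N]
    (hHom : ∀ ψ : Gamma0 N →* Multiplicative (ZMod p),
      (∀ γ : Gamma0 N, (∃ k : ℕ, ((γ : SL(2, ℤ)) 1 1 : ℤ) = (p : ℤ) ^ k ∨ ((γ : SL(2, ℤ)) 1 1 : ℤ) = -((p : ℤ) ^ k)) →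
        ψ γ = 1) →
      ∀ γ : Gamma0 N, (∃ k : ℕ, ((((γ : SL(2, ℤ)) 1 1 : ℤ) : ZMod N)) = (p : ZMod N) ^ k ∨
        ((((γ : SL(2, ℤ)) 1 1 : ℤ) : ZMod N)) = -((p : ZMod N) ^ k)) → ψ γ = 1) :
    ∀ ψ : Gamma0 N →* Multiplicative (ZMod p),
      (∀ γ : Gamma0 N, (∃ k : ℕ, ((γ : SL(2, ℤ)) 1 1 : ℤ) = (p : ℤ) ^ k ∨ ((γ : SL(2, ℤ)) 1 1 : ℤ) = -((p : ℤ) ^ k)) →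
        ψ γ = 1) →
      ∃ χ : (ZMod N)ˣ →* Multiplicative (ZMod p),
        (∀ u : (ZMod N)ˣ, (u : ZMod N) = (p : ZMod N) → χ u = 1) ∧
        ∀ (γ : Gamma0 N) (u : (ZMod N)ˣ), (u : ZMod N) = (((γ : SL(2, ℤ)) 1 1 : ℤ) : ZMod N) → ψ γ = χ u := by
  intro ψ hkill
  have dbar_mul : ∀ γ δ : Gamma0 N, ((((γ * δ : Gamma0 N) : SL(2, ℤ)) 1 1 : ℤ) : ZMod N) =
      ((((γ : SL(2, ℤ)) 1 1 : ℤ) : ZMod N)) * ((((δ : SL(2, ℤ)) 1 1 : ℤ) : ZMod N)) :=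
    fun γ δ ↦ map_mul (Gamma0Map N) γ δ
  -- `ψ` kills `Γ′`
  have hΓ' : ∀ γ : Gamma0 N, (∃ k : ℕ, ((((γ : SL(2, ℤ)) 1 1 : ℤ) : ZMod N)) = (p : ZMod N) ^ k ∨
      ((((γ : SL(2, ℤ)) 1 1 : ℤ) : ZMod N)) = -((p : ZMod N) ^ k)) → ψ γ = 1 :=
    hHom ψ hkill
  -- in particular `ψ` kills `ker (d mod N)`
  have hker1 : ∀ γ : Gamma0 N, ((((γ : SL(2, ℤ)) 1 1 : ℤ) : ZMod N)) = 1 → ψ γ = 1 :=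
    fun γ hγ ↦ hΓ' γ ⟨0, Or.inl (by rw [hγ, pow_zero])⟩
  -- two elements with the same `d mod N` have the same `ψ`
  have hψeq : ∀ γ δ : Gamma0 N, ((((γ : SL(2, ℤ)) 1 1 : ℤ) : ZMod N)) = ((((δ : SL(2, ℤ)) 1 1 : ℤ) : ZMod N)) →
      ψ γ = ψ δ := by
    intro γ δ hγδ
    have h1 : ((((γ * δ⁻¹ : Gamma0 N) : SL(2, ℤ)) 1 1 : ℤ) : ZMod N) = 1 := by
      rw [dbar_mul, hγδ, mul_comm, dbar_inv_mul]
    have h2 := hker1 (γ * δ⁻¹) h1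
    rwa [map_mul, map_inv, mul_inv_eq_one] at h2
  -- Bézout sections
  choose sect hsect using fun u : (ZMod N)ˣ ↦ exists_gamma0_dbar_eq u
  -- `χ u := ψ (sect u)`
  let χ : (ZMod N)ˣ →* Multiplicative (ZMod p) :=
    { toFun := fun u ↦ ψ (sect u)
      map_one' := hker1 _ (by rw [hsect, Units.val_one])
      map_mul' := fun u v ↦ by
        rw [← map_mul]
        apply hψeq
        rw [dbar_mul, hsect, hsect, hsect, Units.val_mul] }
  have hχ : ∀ u, χ u = ψ (sect u) := fun u ↦ rfl
  refine ⟨χ, ?_, ?_⟩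
  · intro u hu
    rw [hχ]
    exact hΓ' _ ⟨1, Or.inl (by rw [hsect, hu, pow_one])⟩
  · intro γ u hu
    rw [hχ]
    exact hψeq γ (sect u) (by rw [hsect, hu])

end Summit.BirchSwinnertonDyer.BirchSwinnertonDyer.Theorems.SmallImageLemmaPrimeReduction
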